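import Summits.NavierStokesRegularity.FunctionalMining.TopEigHeatStable
import HarnessLib

/-!
# FunctionalMining — Proposition L-λ(η) TYPED: heat coercivity of `∫λ₁^q` on the TOP-GAP class `λ₂ ≤ (1−η)λ₁` (dict seat, staged)

HONEST FRAMING. Search for candidate a priori estimates; no regularity claim. Nothing about
Navier–Stokes is proved or asserted in this file. It types the ONE proved partial case of the open node
Lemma L-λ(q) (`TopEigHeatCoercivePos q`, `TopEigHeatCoercive.lean`; equivalently `0 < C_λ(q)`) as named
`Prop`s, and proves only BOOKKEEPING: restriction of coercivity to a sub-class, monotonicity in the rate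
and in the gap parameter, the rate-`0` case (the heat sieve of `TopEigHeatStable.lean`), and the Lean
reading of the no-go seat's COROLLARY "a violating sequence must develop near-biaxial points".

WHAT IS TYPED (SIEVELD §3.4b (4), no-go seat gen 9, 2026-08-20; paper, not kernel-checked).
*Proposition L-λ(η).* Fix `η ∈ (0, 1]` and `2 ≤ q ≤ 6`. Every smooth zero-mean divergence-free `u` on
the 3-torus with `λ₂(S) ≤ (1 − η) λ₁(S)` POINTWISE (`S = sym ∇u`, `λ₁ ≥ λ₂ ≥ λ₃` its eigenvalues)
satisfies `D₀(u) ≥ c(q, η) · F_q(u)` (`F_q = ∫λ₁^q`, `D₀` = the initial decay rate of `F_q` along the heat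
flow = the tree's `heatDissipation`), with `c(2, η) = η / (6 (1 + √3)²) ≈ η/45` in SIEVELD units
(`(ℝ/2πℤ)³`), i.e. `4π² · η / (6 (1 + √3)²)` on the tree's unit torus `(ℝ/ℤ)³` (`R_q = D₀/F_q` scales
as wavenumber², `TopEigHeatCoerciveRate.lean`). Proof on paper (q = 2): on the closed cone
`{λ₂ ≤ (1−η)λ₁}` the map `S ↦ M := λ₁ e₁ ⊗ e₁` is Lipschitz, the exact dissipation identity gives
`D₀ ≥ 2‖∇λ₁‖² + 4η‖λ₁∇e₁‖²`, hence `‖div M‖₂² ≤ ((1+√3)²/(2η)) D₀`, and `F₂ = ∫S:M = −∫u·div M ≤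
‖u‖₂ ‖div M‖₂` with `‖u‖₂ ≤ ‖∇u‖₂ ≤ √12 F₂^{1/2}` (Poincaré at the first shell, `|S|² ≤ 6λ₁²`).
*Corollary.* If L-λ(q) fails, every violating sequence `R_q(u_n) → 0` has `ess-sup λ₂/λ₁ → 1`: it must
leave every top-gap class, i.e. develop NEAR-BIAXIAL points (`λ₂ ≈ λ₁`). The class `η = 1` (`λ₂ ≤ 0`)
contains every planar / 2.5-D / crossed-shear field (Sieve K's class `𝒵`); turbulence phenomenology
`λ₁ : λ₂ : λ₃ ≈ 3 : 1 : −4` sits at `η ≈ 2/3`.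

DECLS (namespace `Summit.NavierStokesRegularity.FunctionalMining`; general index type `d`, the
`card d = 3` clause inside the `Prop`s as in `HeatCoercive`):
* `HeatCoerciveOn P Φ c` — `HeatCoercive Φ c` restricted to the fields satisfying `P`;
* `StrainGapClass η v := ∀ x, λ₂(x) ≤ (1 − η) · λ₁(x)` (tree densities `torusStrainMidEig`,
  `torusStrainTopEig` of `StrainEigen.lean`);
* `TopEigHeatCoerciveOnGap q η c := HeatCoerciveOn (StrainGapClass η) (∫(λ₁⁺)^q) c`;
* `topGapRateTwo η := 4π² η / (6 (1 + √3)²)` — the paper constant at `q = 2`, unit torus;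
* **`TopEigGapCoerciveTwo η := TopEigHeatCoerciveOnGap 2 η (topGapRateTwo η)`** = Proposition L-λ(η) at
  `q = 2` with its constant, and **`TopEigGapCoercivePos q η := ∃ c > 0, TopEigHeatCoerciveOnGap q η c`**
  = Proposition L-λ(η) in existential form (claimed on paper for `2 ≤ q ≤ 6`, `0 < η ≤ 1`) — both
  `@[conjecture] def`s: named, NOT asserted, NOT kernel-checked;
* bookkeeping: `HeatCoercive.on`, `HeatCoerciveOn.mono`, `HeatCoerciveOn.of_imp`,
  `torusStrainTopEig_nonneg` (`λ₁ ≥ 0` for smooth divergence-free fields at `card d = 3`),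
  `StrainGapClass.of_le` (a larger `η` is a smaller class), `not_strainGapClass_iff` (`¬` class `η` ⟺ a
  point with `(1−η)λ₁ < λ₂`), `TopEigHeatCoercive.onGap` (L-λ(q) at rate `c` ⇒ the gap statement at rate
  `c`, every `η`), `TopEigHeatCoercivePos.gapCoercivePos`, `TopEigHeatCoerciveOnGap.mono` /
  `.of_le_eta`, `TopEig.topEigHeatCoerciveOnGap_zero` (rate `0` on every class, `q ≥ 1`, from
  `TopEig.topEigHeatCoercive_zero` p317514), and the COROLLARY in kernel form
  `exists_violator_outside_gap` / `violators_outside_gap_of_not_pos`: gap coercivity at rate `c₀` and the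
  failure of `TopEigHeatCoercive q c` for some `c ≤ c₀` produce a smooth zero-mean divergence-free field
  OUTSIDE the gap class with `heatDissipation < c · ∫λ₁^q`.

WHAT THIS BUYS (honest). A kernel TARGET for the only proved partial case of L-λ, in the grammar of the
open node, so that a proof of Proposition L-λ(η) in the tree would make the Corollary a tree theorem
(the `violators_outside_gap_of_not_pos` direction is already kernel, by pure logic); the restriction of
the open question to "near-biaxial" structures is then citable BY NAME. It decides nothing: the verdict of
the six rows `ES.lam1.q / ES.neglam3.q | T_LD | G1` (`q = 2, 3, 4`; A12: HOLDS ∃κ conditionally on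
L-λ(q)) is unchanged, and no number is claimed (`inf R₂ ≤ 0.4586(4)` at `K = 128`, census-1, by value).

[ours: `pub-nsfunc` dict seat g26, 2026-08-22; source: no-go seat SIEVELD §3.4b (1), (3), (4) and its
COROLLARY (`pub-nsfunc-nogo/SIEVELD.md` v1.9zzh); no literature claim is made — Proposition L-λ(η) is an
internally-minted PAPER result (ours), typed here as a conjecture-tagged `Prop`, never a Literature fact.]
-/

noncomputable section

namespace Summit.NavierStokesRegularity.FunctionalMining

open MeasureTheory Set Real Literature.Analysis.FunctionSpaces Literature.Analysis.FluidPDE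

variable {d : Type*} [Fintype d] [DecidableEq d]

/-! ### Coercivity restricted to a sub-class of fields -/

/-- **`HeatCoerciveOn P Φ c`** — `HeatCoercive Φ c` (`c · Φ v ≤ heatDissipation Φ v` for every smooth,
divergence-free, zero-mean `v` on `T³`) restricted to the fields satisfying the predicate `P`.
[ours, bookkeeping] -/
def HeatCoerciveOn (P : (UnitAddTorus d → EuclideanSpace ℝ d) → Prop)
    (Φ : (UnitAddTorus d → EuclideanSpace ℝ d) → ℝ) (c : ℝ) : Prop :=
  Fintype.card d = 3 → ∀ v : UnitAddTorus d → EuclideanSpace ℝ d,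
    Torus.IsSmooth v → Torus.IsDivFree v → Torus.HasZeroMean v → P v → c * Φ v ≤ heatDissipation Φ v

/-- Coercivity on all fields is coercivity on every sub-class. [ours, bookkeeping] -/
theorem HeatCoercive.on {Φ : (UnitAddTorus d → EuclideanSpace ℝ d) → ℝ} {c : ℝ}
    (h : HeatCoercive Φ c) (P : (UnitAddTorus d → EuclideanSpace ℝ d) → Prop) :
    HeatCoerciveOn P Φ c :=
  fun hd v hv hdiv hmean _ => h hd v hv hdiv hmean

/-- The trivial class is the unrestricted statement. [ours, bookkeeping] -/
theorem heatCoerciveOn_true_iff (Φ : (UnitAddTorus d → EuclideanSpace ℝ d) → ℝ) (c : ℝ) :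
    HeatCoerciveOn (fun _ => True) Φ c ↔ HeatCoercive Φ c :=
  ⟨fun h hd v hv hdiv hmean => h hd v hv hdiv hmean trivial,
    fun h => h.on _⟩

/-- A smaller rate is a weaker statement on any class, for non-negative functionals.
[ours, bookkeeping] -/
theorem HeatCoerciveOn.mono {P : (UnitAddTorus d → EuclideanSpace ℝ d) → Prop}
    {Φ : (UnitAddTorus d → EuclideanSpace ℝ d) → ℝ} {c c' : ℝ}
    (h : HeatCoerciveOn P Φ c) (hΦ : ∀ v, 0 ≤ Φ v) (hc : c' ≤ c) : HeatCoerciveOn P Φ c' :=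
  fun hd v hv hdiv hmean hP =>
    (mul_le_mul_of_nonneg_right hc (hΦ v)).trans (h hd v hv hdiv hmean hP)

/-- A smaller class is a weaker statement: if every (smooth, divergence-free, zero-mean) field of the
class `P'` lies in the class `P`, coercivity on `P` gives coercivity on `P'`. [ours, bookkeeping] -/
theorem HeatCoerciveOn.of_imp {P P' : (UnitAddTorus d → EuclideanSpace ℝ d) → Prop}
    {Φ : (UnitAddTorus d → EuclideanSpace ℝ d) → ℝ} {c : ℝ} (h : HeatCoerciveOn P Φ c)
    (hPP' : Fintype.card d = 3 → ∀ v, Torus.IsSmooth v → Torus.IsDivFree v → Torus.HasZeroMean v →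
      P' v → P v) :
    HeatCoerciveOn P' Φ c :=
  fun hd v hv hdiv hmean hP' => h hd v hv hdiv hmean (hPP' hd v hv hdiv hmean hP')

/-! ### The top eigenvalue of a divergence-free strain is non-negative -/

/-- Every sorted strain eigenvalue is bounded by the top one. [folklore] -/
theorem torusStrainEig_le_topEig (v : UnitAddTorus d → EuclideanSpace ℝ d) (x : UnitAddTorus d)
    (k : Fin (Fintype.card d)) : torusStrainEig v x k ≤ torusStrainTopEig v x :=
  le_ciSup (Set.finite_range _).bddAbove k

/-- **`λ₁ ≥ 0`** for smooth divergence-free fields at `card d = 3`: the eigenvalues sum to `tr S = 0` and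
each is at most `λ₁`, so `0 = ∑ λₖ ≤ 3 λ₁`. [folklore] -/
theorem torusStrainTopEig_nonneg (hd : Fintype.card d = 3) {v : UnitAddTorus d → EuclideanSpace ℝ d}
    (hv : Torus.IsSmooth v) (hdiv : Torus.IsDivFree v) (x : UnitAddTorus d) :
    0 ≤ torusStrainTopEig v x := by
  have hsum := sum_torusStrainEig_eq_zero hv hdiv x
  have hle : ∑ k, torusStrainEig v x k ≤ ∑ _k : Fin (Fintype.card d), torusStrainTopEig v x :=
    Finset.sum_le_sum fun k _ => torusStrainEig_le_topEig v x k
  rw [hsum, Finset.sum_const, Finset.card_univ, Fintype.card_fin, hd, nsmul_eq_mul] at hle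
  norm_num at hle
  linarith

/-! ### The top-gap class `λ₂ ≤ (1 − η) λ₁` -/

/-- **`StrainGapClass η v`**: the strain of `v` has a uniform TOP GAP, `λ₂(x) ≤ (1 − η) · λ₁(x)` at every
point (`η ∈ (0, 1]`; `η = 1`: `λ₂ ≤ 0`, which contains every planar / 2.5-D / crossed-shear field;
`η → 0`: no condition beyond `λ₂ ≤ λ₁`). Near-BIAXIAL points `λ₂ ≈ λ₁ > 0` are exactly what the class
excludes. Tree densities `torusStrainMidEig` (`λ₂`) and `torusStrainTopEig` (`λ₁`) of `StrainEigen.lean`.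
[ours, bookkeeping; SIEVELD §3.4b (4)] -/
def StrainGapClass (η : ℝ) (v : UnitAddTorus d → EuclideanSpace ℝ d) : Prop :=
  ∀ x, torusStrainMidEig v x ≤ (1 - η) * torusStrainTopEig v x

/-- `η = 1` is the class `λ₂ ≤ 0`. [ours, bookkeeping] -/
theorem strainGapClass_one_iff (v : UnitAddTorus d → EuclideanSpace ℝ d) :
    StrainGapClass 1 v ↔ ∀ x, torusStrainMidEig v x ≤ 0 := by
  simp [StrainGapClass]

/-- A field is OUTSIDE the class `η` iff it has a point with `(1 − η) λ₁ < λ₂` (a near-biaxial point when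
`η` is small). [ours, bookkeeping] -/
theorem not_strainGapClass_iff (η : ℝ) (v : UnitAddTorus d → EuclideanSpace ℝ d) :
    ¬ StrainGapClass η v ↔ ∃ x, (1 - η) * torusStrainTopEig v x < torusStrainMidEig v x := by
  simp [StrainGapClass, not_le]

/-- A larger `η` is a smaller class, wherever `λ₁ ≥ 0`. [ours, bookkeeping] -/
theorem StrainGapClass.of_le {η η' : ℝ} {v : UnitAddTorus d → EuclideanSpace ℝ d}
    (h : StrainGapClass η' v) (hη : η ≤ η') (hv : ∀ x, 0 ≤ torusStrainTopEig v x) :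
    StrainGapClass η v :=
  fun x => (h x).trans (mul_le_mul_of_nonneg_right (by linarith) (hv x))

/-- The same for smooth divergence-free fields at `card d = 3` (`λ₁ ≥ 0` automatically).
[ours, bookkeeping] -/
theorem StrainGapClass.of_le_of_divFree (hd : Fintype.card d = 3) {η η' : ℝ}
    {v : UnitAddTorus d → EuclideanSpace ℝ d} (h : StrainGapClass η' v) (hη : η ≤ η')
    (hv : Torus.IsSmooth v) (hdiv : Torus.IsDivFree v) : StrainGapClass η v :=
  h.of_le hη (torusStrainTopEig_nonneg hd hv hdiv)

/-! ### Proposition L-λ(η), typed -/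

/-- **`TopEigHeatCoerciveOnGap q η c`**: `c · ∫(λ₁⁺)^q ≤ heatDissipation (∫(λ₁⁺)^q) v` for every smooth,
zero-mean, divergence-free `v` on `T³` IN THE TOP-GAP CLASS `λ₂ ≤ (1 − η) λ₁` — Lemma L-λ(q) at rate `c`
restricted to the class. [ours, bookkeeping] -/
def TopEigHeatCoerciveOnGap (q η c : ℝ) : Prop :=
  HeatCoerciveOn (d := d) (StrainGapClass η) (torusTopEigMoment q) c

/-- The paper constant of Proposition L-λ(η) at `q = 2` on the UNIT torus: `4π² · η / (6 (1 + √3)²)`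
(SIEVELD units `η / (6 (1 + √3)²) ≈ η / 44.8`; the factor `4π²` is the wavenumber² of the first shell of
`(ℝ/ℤ)³`). [ours; SIEVELD §3.4b (4)] -/
def topGapRateTwo (η : ℝ) : ℝ :=
  4 * π ^ 2 * η / (6 * (1 + Real.sqrt 3) ^ 2)

/-- The paper constant is positive for `η > 0`. [ours, bookkeeping] -/
theorem topGapRateTwo_pos {η : ℝ} (hη : 0 < η) : 0 < topGapRateTwo η := by
  unfold topGapRateTwo
  positivity

/-- The paper constant is monotone in `η`. [ours, bookkeeping] -/
theorem topGapRateTwo_mono {η η' : ℝ} (hη : η ≤ η') : topGapRateTwo η ≤ topGapRateTwo η' := by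
  unfold topGapRateTwo
  have h6 : 0 < 6 * (1 + Real.sqrt 3) ^ 2 := by positivity
  exact div_le_div_of_nonneg_right (by nlinarith [Real.pi_pos, sq_nonneg π]) h6.le

/-- **Proposition L-λ(η) at `q = 2`, with its constant (SIEVELD §3.4b (4); PAPER, not kernel-checked):**
`TopEigHeatCoerciveOnGap 2 η (4π² η / (6 (1 + √3)²))` — claimed for every `η ∈ (0, 1]`. Proof on paper:
Lipschitz spectral projector `M = λ₁ e₁ ⊗ e₁` on the closed cone, the exact dissipation identity,
`F₂ = −∫ u · div M`, Poincaré. A named `Prop`, NOT asserted here. [ours; paper result, typed] -/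
@[conjecture] def TopEigGapCoerciveTwo (η : ℝ) : Prop :=
  TopEigHeatCoerciveOnGap (d := d) 2 η (topGapRateTwo η)

/-- **Proposition L-λ(η), existential form: `∃ c > 0, TopEigHeatCoerciveOnGap q η c`** — claimed on paper
for `2 ≤ q ≤ 6` and `0 < η ≤ 1` (SIEVELD §3.4b (4): "General q: `M_q = λ₁^{q−2} M`, Hölder
`2/q + (q−2)/q = 1` and `‖u‖_q ≲ ‖∇u‖₂` for `q ≤ 6`"; no constant stated for `q > 2`). A named `Prop`,
NOT asserted here. [ours; paper result, typed] -/
@[conjecture] def TopEigGapCoercivePos (q η : ℝ) : Prop :=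
  ∃ c : ℝ, 0 < c ∧ TopEigHeatCoerciveOnGap (d := d) q η c

/-- The `q = 2` statement with its constant gives the existential form. [ours, bookkeeping] -/
theorem TopEigGapCoerciveTwo.pos {η : ℝ} (h : TopEigGapCoerciveTwo (d := d) η) (hη : 0 < η) :
    TopEigGapCoercivePos (d := d) 2 η :=
  ⟨topGapRateTwo η, topGapRateTwo_pos hη, h⟩

/-- Lemma L-λ(q) at rate `c` contains the gap statement at rate `c`, for every `η`.
[ours, bookkeeping] -/
theorem TopEigHeatCoercive.onGap {q c : ℝ} (h : TopEigHeatCoercive (d := d) q c) (η : ℝ) :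
    TopEigHeatCoerciveOnGap (d := d) q η c :=
  HeatCoercive.on h _

/-- Lemma L-λ(q) contains Proposition L-λ(η) in existential form, for every `η`. [ours, bookkeeping] -/
theorem TopEigHeatCoercivePos.gapCoercivePos {q : ℝ} (h : TopEigHeatCoercivePos (d := d) q) (η : ℝ) :
    TopEigGapCoercivePos (d := d) q η := by
  obtain ⟨c, hc, hcoer⟩ := h
  exact ⟨c, hc, hcoer.onGap η⟩

/-- Monotonicity of the gap statement in the rate. [ours, bookkeeping] -/
theorem TopEigHeatCoerciveOnGap.mono {q η c c' : ℝ} (h : TopEigHeatCoerciveOnGap (d := d) q η c)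
    (hc : c' ≤ c) : TopEigHeatCoerciveOnGap (d := d) q η c' :=
  HeatCoerciveOn.mono h (torusTopEigMoment_nonneg q) hc

/-- Monotonicity of the gap statement in `η`: a larger `η` is a smaller class, hence a weaker statement
(uses `λ₁ ≥ 0` for divergence-free fields). [ours, bookkeeping] -/
theorem TopEigHeatCoerciveOnGap.of_le_eta {q η η' c : ℝ} (h : TopEigHeatCoerciveOnGap (d := d) q η c)
    (hη : η ≤ η') : TopEigHeatCoerciveOnGap (d := d) q η' c :=
  HeatCoerciveOn.of_imp h fun hd _ hv hdiv _ hP' => StrainGapClass.of_le_of_divFree hd hP' hη hv hdiv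

/-- Monotonicity of the existential form in `η`. [ours, bookkeeping] -/
theorem TopEigGapCoercivePos.of_le_eta {q η η' : ℝ} (h : TopEigGapCoercivePos (d := d) q η)
    (hη : η ≤ η') : TopEigGapCoercivePos (d := d) q η' := by
  obtain ⟨c, hc, hcoer⟩ := h
  exact ⟨c, hc, hcoer.of_le_eta hη⟩

namespace TopEig

/-- Rate `0` holds on every gap class, for every real `q ≥ 1`: the eigen core passes the static heat
sieve (`TopEig.topEigHeatCoercive_zero`, `TopEigHeatStable.lean` p317514). So the admissible rates of the
gap statement, like those of L-λ(q), form a ray containing `0`; Proposition L-λ(η) says the ray reaches a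
positive number on the class. [ours, bookkeeping] -/
theorem topEigHeatCoerciveOnGap_zero {q : ℝ} (hq : 1 ≤ q) (η : ℝ) :
    TopEigHeatCoerciveOnGap (d := Fin 3) q η 0 :=
  (topEigHeatCoercive_zero hq).onGap η

end TopEig

/-! ### The Corollary: violators live outside every gap class -/

/-- **COROLLARY of Proposition L-λ(η), kernel form (pure logic).** If `∫λ₁^q` is heat-coercive at rate
`c₀` on the gap class `λ₂ ≤ (1−η)λ₁`, and Lemma L-λ(q) FAILS at some rate `c ≤ c₀`, then the failure
is witnessed by a smooth, zero-mean, divergence-free field OUTSIDE the class — one with a point where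
`(1−η)λ₁ < λ₂` — whose heat dissipation is below `c · ∫λ₁^q`. (SIEVELD §3.4b COROLLARY: "if L-λ fails,
every violating sequence has `ess-sup λ₂/λ₁ → 1`: it must develop near-biaxial points".)
[ours, bookkeeping] -/
theorem exists_violator_outside_gap {q η c₀ c : ℝ} (hgap : TopEigHeatCoerciveOnGap (d := d) q η c₀)
    (hnot : ¬ TopEigHeatCoercive (d := d) q c) (hc : c ≤ c₀) :
    ∃ v : UnitAddTorus d → EuclideanSpace ℝ d, Torus.IsSmooth v ∧ Torus.IsDivFree v ∧
      Torus.HasZeroMean v ∧ ¬ StrainGapClass η v ∧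
      heatDissipation (torusTopEigMoment q) v < c * torusTopEigMoment q v := by
  simp only [TopEigHeatCoercive, HeatCoercive, not_forall, not_le, exists_prop] at hnot
  obtain ⟨hd, v, hv, hdiv, hmean, hlt⟩ := hnot
  refine ⟨v, hv, hdiv, hmean, fun hP => ?_, hlt⟩
  have h1 : c₀ * torusTopEigMoment q v ≤ heatDissipation (torusTopEigMoment q) v :=
    hgap hd v hv hdiv hmean hP
  have h2 : c * torusTopEigMoment q v ≤ c₀ * torusTopEigMoment q v :=
    mul_le_mul_of_nonneg_right hc (torusTopEigMoment_nonneg q v)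
  linarith

/-- **The Corollary against the open node.** If Proposition L-λ(η) holds (existential form, rate `c₀`)
and Lemma L-λ(q) (`TopEigHeatCoercivePos q`) FAILS, then for every rate `0 < c ≤ c₀` there is a smooth
zero-mean divergence-free field outside the gap class `η` with `heatDissipation < c · ∫λ₁^q`: a
violating sequence (`c → 0`) lives outside every gap class, i.e. develops near-biaxial points.
[ours, bookkeeping] -/
theorem violators_outside_gap_of_not_pos {q η : ℝ} (hgap : TopEigGapCoercivePos (d := d) q η)
    (hfail : ¬ TopEigHeatCoercivePos (d := d) q) :
    ∃ c₀ : ℝ, 0 < c₀ ∧ ∀ c : ℝ, 0 < c → c ≤ c₀ →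
      ∃ v : UnitAddTorus d → EuclideanSpace ℝ d, Torus.IsSmooth v ∧ Torus.IsDivFree v ∧
        Torus.HasZeroMean v ∧ ¬ StrainGapClass η v ∧
        heatDissipation (torusTopEigMoment q) v < c * torusTopEigMoment q v := by
  obtain ⟨c₀, hc₀, hcoer⟩ := hgap
  refine ⟨c₀, hc₀, fun c hc hcc₀ => exists_violator_outside_gap hcoer ?_ hcc₀⟩
  intro h
  exact hfail ⟨c, hc, h⟩

/-- Contrapositive bookkeeping: gap coercivity at a positive rate on SOME class `η`, together with
coercivity OUTSIDE that class at a positive rate (a hypothetical complementary estimate, typed as a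
`HeatCoerciveOn` on the complement), would give Lemma L-λ(q). This is only the logical shape of a
two-regime proof; no such complementary estimate is known or claimed. [ours, bookkeeping] -/
theorem topEigHeatCoercivePos_of_gap_and_complement {q η c₁ c₂ : ℝ}
    (hgap : TopEigHeatCoerciveOnGap (d := d) q η c₁)
    (hcomp : HeatCoerciveOn (d := d) (fun v => ¬ StrainGapClass η v) (torusTopEigMoment q) c₂)
    (hc₁ : 0 < c₁) (hc₂ : 0 < c₂) : TopEigHeatCoercivePos (d := d) q := by
  refine ⟨min c₁ c₂, lt_min hc₁ hc₂, fun hd v hv hdiv hmean => ?_⟩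
  by_cases hP : StrainGapClass η v
  · exact (mul_le_mul_of_nonneg_right (min_le_left _ _) (torusTopEigMoment_nonneg q v)).trans
      (hgap hd v hv hdiv hmean hP)
  · exact (mul_le_mul_of_nonneg_right (min_le_right _ _) (torusTopEigMoment_nonneg q v)).trans
      (hcomp hd v hv hdiv hmean hP)

end Summit.NavierStokesRegularity.FunctionalMining

end
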